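import Summits.QuantumFields.BalabanUV.Beta.D1BFx.DshWordMass
import Summits.QuantumFields.BalabanUV.Beta.D1BFx.DshFaceMass

/-!
# `BalabanUV.Beta.D1BFx.DshWordFaceMass` — road «BF-x», binder row D1, PART 24-hyb HEAD (OWNER d1-p2 g25; SPEC v1.2 §4; N-g25-1 «O-6′ split WANTED»; leaf-03 g33 N-1 Q-1∕Q-2):
# **THE FACE SPLIT OF THE `Dsh`-WORD's MASS — interior bonds (both endpoints in one block) weighted `Si`, face-crossing bonds weighted `Sf`:
# `Σ' Σ w·|W| ≤ (Ch·Cg·(E+1)²·(4·(2·(Si·T₀ + Sf·F₀)))·Zl 4 (δ∕2·n))·e^{−(δ∕2·n)|y′ − y|₁}`, `T₀ = n^{3+1}·((3+1)·n)` (O-6 block mass), `F₀ = (3+1)·((3+1)·n^{3+1})` (O-6′ face mass) —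
# ONE POWER OF `n` APART** (FILE 4 of the O-9∕O-10 chain; FILE 5 `DshWordSplitTadpole` = the weighted tadpole; FILE 6 `ChartDefectRowDdUniform` = the HEAD's row (dd) n-free at its own pin)

HONEST DEPENDENCY (cell records, verbatim): «continuum YM on T⁴ ⇐ BetaPertH ∧ nine spine estimates (0/9 proved); BetaPertH ⇐ (D1) ∧ (D4) ∧
CAP+tail; G-an2-4 gates asym, D1 and NE2/3/4.»  HONEST FRAMING (cell contract, verbatim): «discharging `BetaPertH` makes Bałaban's UV stability
UNCONDITIONAL — a real constructive-QFT result; it is NOT the continuum limit and NOT the Clay problem.»  THIS MODULE is [folklore] `ℓ¹` bookkeeping BY NAME over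
LANDED objects: FILE 1 `DshWordMass` (entries, column masses), O-6 `DshBlockMass` (block totals), O-6′ `DshFaceMass` (`sum_hyperplane_abs_Dsh_le ∕ _succ_le`: the far
hyperplane `b_α = n − 1` of each bond direction carries `≤ (3+1)·n^{3+1}`), lit `AveragingContours.blk_block`, `KKTFluctuationEnergy.tsum_blocks`.  The weights `g`, `h` are
ARBITRARY with DISPLAYED envelopes; `Si`, `Sf ≥ 0` are free reals.  No `def`, no `def … : Prop`, nothing cited, 0 sorry.  0∕4 row-D1 binders; (K) NOT closed; (J1) ONE OPEN ROW;
NOT D1, NEVER «G-an2-4 closed», NOT `BetaPertH`, NOT continuum, NOT Clay.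

ABSOLUTE RULE (cell charter, verbatim): «No internally-minted statement may enter as a cited fact. Every hypothesis is either kernel-proved in
this package or a verbatim quotation of a PUBLISHED theorem with page reference. The manuscript(s) under audit are NOT citable for their own
disputed steps — they are the thing under adjudication; programme-internal (2001/route/tribunal) claims are never citable.»

CONTENT ([folklore]; `w(α, y) := if blk n (y + e_α) = blk n y then Si else Sf` — the bond `(α, y)` inside its block or crossing its far face).
* §8 `toSite_update_succ`, `blk_bond_eq_of_lt`, `apply_eq_of_blk_ne` (a crossing bond sits on `b_α = n − 1`); **`sum_weight_abs_Dsh_block_le ∕ _succ_le`**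
  (`Σ_α Σ_{b∈box} w·|Dsh n (n•X + b) (n•X) (inl α) (inr m)| ≤ Si·T₀ + Sf·F₀`, `n = 1` by the block total); **`tsum_weight_abs_Dsh_col_le`** (`≤ 2·(Si·T₀ + Sf·F₀)`);
  **`word_col_wmass_le`**, **`word_inl_inr_wmass_le`** (the weighted twins of FILE 1 §2).
Unit `b2b-balaban-beta-d1-formalise-leaf-01` (gen 33), road «BF-x»; OFFER O-10 part 1.  Not in print; our bookkeeping.  No existing file touched.
-/

noncomputable section

namespace Summit.QuantumFields.BalabanUV.Beta.D1BFx.DshWordFaceMass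

open Finset
open scoped BigOperators
open Literature.MathematicalPhysics.QuantumFieldTheory
open Literature.MathematicalPhysics.QuantumFieldTheory.LatticeForm (quo)
open Literature.MathematicalPhysics.QuantumFieldTheory.Balaban1983to89
open Literature.MathematicalPhysics.QuantumFieldTheory.Balaban1983to89.Beta
open B12Sec2to5 (l1 l1_nonneg)
open ExpKernelCalculus (MKer Zl Zl_pos Zl_nonneg comp tr tadpole l1_sub_triangle l1_sub_symm l1_natSmul summable_exp_shift' tsum_exp_shift')
open OneStepResolventKernel (Fib quo_zsmul proj_zsmul eq_zsmul_quo_of_proj)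
open AffineAveraging (Site box toSite unitVec unitVec_apply)
open AveragingContours (blk blk_block)
open KKTFluctuationEnergy (tsum_blocks)
open Summit.QuantumFields.BalabanUV.Beta.BorderedHessian (diagK)
open Summit.QuantumFields.BalabanUV.Beta.DshAn1 (Dsh Dsh_inl_inl Dsh_inr_inr Dsh_inl_inr Dsh_inr_inl_eq_neg Dsh_ne_zero_window)
open Summit.QuantumFields.BalabanUV.Beta.D1BFx.DshBlockMass (sum_abs_Dsh_block_le sum_abs_Dsh_block_succ_le Dsh_inl_inr_eq_zero_of_blk_ne)
open Summit.QuantumFields.BalabanUV.Beta.D1BFx.DshFaceMass (sum_hyperplane_abs_Dsh_le sum_hyperplane_abs_Dsh_succ_le)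
open Summit.QuantumFields.BalabanUV.Beta.D1BFx.DshWordMass

/-! ## §8 The FACE split of the masses: interior bonds (both endpoints in one block) weighted `Si`, face-crossing bonds weighted `Sf` -/

section Face

variable {n : ℕ} [NeZero n]

/-- [folklore] Bumping one coordinate of a box offset: `toSite (update b α (b α + 1)) = toSite b + e_α`. -/
theorem toSite_update_succ (b : Fin (3 + 1) → ℕ) (α : Fin (3 + 1)) :
    toSite (Function.update b α (b α + 1)) = toSite b + unitVec α := by
  funext i
  simp only [toSite, Pi.add_apply, unitVec_apply, Function.update_apply]
  split_ifs with h
  · subst h; push_cast; ring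
  · simp

omit [NeZero n] in
/-- [folklore] **A BOND INSIDE A BLOCK**: for `b ∈ box 4 n` with `b α + 1 < n`, the bond `(α, n•Y + b)` has both endpoints in the block `Y`. -/
theorem blk_bond_eq_of_lt {Y : Site (3 + 1)} {b : Fin (3 + 1) → ℕ} (hb : b ∈ box (3 + 1) n) {α : Fin (3 + 1)} (hα : b α + 1 < n) :
    blk n ((n : ℤ) • Y + toSite b + unitVec α) = blk n ((n : ℤ) • Y + toSite b) := by
  have hb' : Function.update b α (b α + 1) ∈ box (3 + 1) n := by
    rw [AffineAveraging.box, Fintype.mem_piFinset] at hb ⊢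
    intro i
    rw [Finset.mem_range]
    by_cases hi : i = α
    · subst hi; rw [Function.update_self]; exact hα
    · rw [Function.update_of_ne hi]; exact Finset.mem_range.1 (hb i)
  rw [add_assoc, ← toSite_update_succ, blk_block Y hb', blk_block Y hb]

omit [NeZero n] in
/-- [folklore] **A FACE-CROSSING BOND SITS ON THE FAR HYPERPLANE**: for `b ∈ box 4 n`, if the bond `(α, n•Y + b)` leaves the block then `b α = n − 1`. -/
theorem apply_eq_of_blk_ne {Y : Site (3 + 1)} {b : Fin (3 + 1) → ℕ} (hb : b ∈ box (3 + 1) n) {α : Fin (3 + 1)}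
    (hne : blk n ((n : ℤ) • Y + toSite b + unitVec α) ≠ blk n ((n : ℤ) • Y + toSite b)) : b α = n - 1 := by
  have hlt : b α < n := by
    rw [AffineAveraging.box, Fintype.mem_piFinset] at hb
    exact Finset.mem_range.1 (hb α)
  by_contra h
  exact hne (blk_bond_eq_of_lt hb (by omega))

/-- [folklore] **THE FACE MASS OF `Dsh`'s FIELD–MULTIPLIER BLOCK, OWN BLOCK** (O-6′ `DshFaceMass.sum_hyperplane_abs_Dsh_le` at the far hyperplanes `b_α = n − 1`, one per bond
direction; for `n = 1` every bond crosses and O-6's block total is the same number): weights `Si` on interior bonds and `Sf` on face-crossing bonds (`0 ≤ Si, Sf`) give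
`Σ_α Σ_{b ∈ box} w(α, n•X + b)·|Dsh n (n•X + b) (n•X) (inl α) (inr m)| ≤ Si·(n^{3+1}·((3+1)·n)) + Sf·((3+1)·(((3:ℝ)+1)·n^{3+1}))`. -/
theorem sum_weight_abs_Dsh_block_le {Si Sf : ℝ} (hSi : 0 ≤ Si) (hSf : 0 ≤ Sf) (X : Site (3 + 1)) (m : Fin (3 + 1)) :
    ∑ α : Fin (3 + 1), ∑ b ∈ box (3 + 1) n,
        (if blk n (((n : ℤ) • X + toSite b) + unitVec α) = blk n ((n : ℤ) • X + toSite b) then Si else Sf) * |Dsh (d := 3) n ((n : ℤ) • X + toSite b) ((n : ℤ) • X) (Sum.inl α) (Sum.inr m)|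
      ≤ Si * ((n : ℝ) ^ (3 + 1) * (((3 : ℝ) + 1) * n)) + Sf * (((3 : ℝ) + 1) * ((((3 : ℕ) : ℝ) + 1) * (n : ℝ) ^ (3 + 1))) := by
  classical
  have hn : 1 ≤ n := Nat.one_le_iff_ne_zero.2 (NeZero.ne n)
  -- pointwise: `w·|D| ≤ Si·|D| + Sf·𝟙[b_α = n−1]·|D|`
  have hpt : ∀ (α : Fin (3 + 1)) (b : Fin (3 + 1) → ℕ), b ∈ box (3 + 1) n →
      (if blk n (((n : ℤ) • X + toSite b) + unitVec α) = blk n ((n : ℤ) • X + toSite b) then Si else Sf) * |Dsh (d := 3) n ((n : ℤ) • X + toSite b) ((n : ℤ) • X) (Sum.inl α) (Sum.inr m)|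
        ≤ Si * |Dsh (d := 3) n ((n : ℤ) • X + toSite b) ((n : ℤ) • X) (Sum.inl α) (Sum.inr m)|
          + Sf * (if b α = n - 1 then |Dsh (d := 3) n ((n : ℤ) • X + toSite b) ((n : ℤ) • X) (Sum.inl α) (Sum.inr m)| else 0) := by
    intro α b hb
    have hD := abs_nonneg (Dsh (d := 3) n ((n : ℤ) • X + toSite b) ((n : ℤ) • X) (Sum.inl α) (Sum.inr m))
    split_ifs with h1 h2 h2
    · nlinarith
    · nlinarith
    · nlinarith
    · exact absurd (apply_eq_of_blk_ne hb h1) h2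
  have e3 : (((3 : ℕ) : ℝ) + 1) = (3 : ℝ) + 1 := by norm_num
  have htot := sum_abs_Dsh_block_le (d := 3) hn X m
  rw [e3] at htot
  -- the face part: one far hyperplane per bond direction
  have hface : ∑ α : Fin (3 + 1), ∑ b ∈ box (3 + 1) n,
      (if b α = n - 1 then |Dsh (d := 3) n ((n : ℤ) • X + toSite b) ((n : ℤ) • X) (Sum.inl α) (Sum.inr m)| else 0)
        ≤ ((3 : ℝ) + 1) * ((((3 : ℕ) : ℝ) + 1) * (n : ℝ) ^ (3 + 1)) := by
    rcases Nat.lt_or_ge n 2 with h1 | h2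
    · -- `n = 1`: the face sum is at most the block total
      have hn1 : n = 1 := by omega
      calc ∑ α : Fin (3 + 1), ∑ b ∈ box (3 + 1) n,
            (if b α = n - 1 then |Dsh (d := 3) n ((n : ℤ) • X + toSite b) ((n : ℤ) • X) (Sum.inl α) (Sum.inr m)| else 0)
          ≤ ∑ α : Fin (3 + 1), ∑ b ∈ box (3 + 1) n, |Dsh (d := 3) n ((n : ℤ) • X + toSite b) ((n : ℤ) • X) (Sum.inl α) (Sum.inr m)| :=
            Finset.sum_le_sum fun α _ => Finset.sum_le_sum fun b _ => by split_ifs <;> simp [abs_nonneg]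
        _ ≤ (n : ℝ) ^ (3 + 1) * (((3 : ℝ) + 1) * n) := htot
        _ ≤ _ := by subst hn1; norm_num
    · have hv : n - 1 ≠ (n - 1) / 2 := by omega
      calc ∑ α : Fin (3 + 1), ∑ b ∈ box (3 + 1) n,
            (if b α = n - 1 then |Dsh (d := 3) n ((n : ℤ) • X + toSite b) ((n : ℤ) • X) (Sum.inl α) (Sum.inr m)| else 0)
          = ∑ α : Fin (3 + 1), ∑ b ∈ (box (3 + 1) n).filter (fun b => b α = n - 1),
              |Dsh (d := 3) n ((n : ℤ) • X + toSite b) ((n : ℤ) • X) (Sum.inl α) (Sum.inr m)| :=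
            Finset.sum_congr rfl fun α _ => by rw [Finset.sum_filter]
        _ ≤ ∑ α : Fin (3 + 1), ∑ α' : Fin (3 + 1), ∑ b ∈ (box (3 + 1) n).filter (fun b => b α = n - 1),
              |Dsh (d := 3) n ((n : ℤ) • X + toSite b) ((n : ℤ) • X) (Sum.inl α') (Sum.inr m)| :=
            Finset.sum_le_sum fun α _ => Finset.single_le_sum
              (f := fun α' => ∑ b ∈ (box (3 + 1) n).filter (fun b => b α = n - 1),
                |Dsh (d := 3) n ((n : ℤ) • X + toSite b) ((n : ℤ) • X) (Sum.inl α') (Sum.inr m)|)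
              (fun α' _ => Finset.sum_nonneg fun b _ => abs_nonneg _) (Finset.mem_univ α)
        _ ≤ ∑ _α : Fin (3 + 1), ((((3 : ℕ) : ℝ) + 1) * (n : ℝ) ^ (3 + 1)) :=
            Finset.sum_le_sum fun α _ => sum_hyperplane_abs_Dsh_le (d := 3) hn X m α hv
        _ = _ := by rw [Finset.sum_const, Finset.card_univ, Fintype.card_fin, nsmul_eq_mul]; push_cast; ring
  calc ∑ α : Fin (3 + 1), ∑ b ∈ box (3 + 1) n,
        (if blk n (((n : ℤ) • X + toSite b) + unitVec α) = blk n ((n : ℤ) • X + toSite b) then Si else Sf) * |Dsh (d := 3) n ((n : ℤ) • X + toSite b) ((n : ℤ) • X) (Sum.inl α) (Sum.inr m)|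
      ≤ ∑ α : Fin (3 + 1), ∑ b ∈ box (3 + 1) n,
          (Si * |Dsh (d := 3) n ((n : ℤ) • X + toSite b) ((n : ℤ) • X) (Sum.inl α) (Sum.inr m)|
            + Sf * (if b α = n - 1 then |Dsh (d := 3) n ((n : ℤ) • X + toSite b) ((n : ℤ) • X) (Sum.inl α) (Sum.inr m)| else 0)) :=
        Finset.sum_le_sum fun α _ => Finset.sum_le_sum fun b hb => hpt α b hb
    _ = Si * ∑ α : Fin (3 + 1), ∑ b ∈ box (3 + 1) n, |Dsh (d := 3) n ((n : ℤ) • X + toSite b) ((n : ℤ) • X) (Sum.inl α) (Sum.inr m)|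
        + Sf * ∑ α : Fin (3 + 1), ∑ b ∈ box (3 + 1) n,
          (if b α = n - 1 then |Dsh (d := 3) n ((n : ℤ) • X + toSite b) ((n : ℤ) • X) (Sum.inl α) (Sum.inr m)| else 0) := by
        simp only [Finset.sum_add_distrib, Finset.mul_sum]
    _ ≤ _ := add_le_add (mul_le_mul_of_nonneg_left htot hSi) (mul_le_mul_of_nonneg_left hface hSf)

/-- [folklore] **THE FACE MASS OF `Dsh`'s FIELD–MULTIPLIER BLOCK, NEIGHBOURING BLOCK** (O-6 `sum_abs_Dsh_block_succ_le` + O-6′ `sum_hyperplane_abs_Dsh_succ_le`): the same bound on `B(X + e_m)`. -/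
theorem sum_weight_abs_Dsh_block_succ_le {Si Sf : ℝ} (hSi : 0 ≤ Si) (hSf : 0 ≤ Sf) (X : Site (3 + 1)) (m : Fin (3 + 1)) :
    ∑ α : Fin (3 + 1), ∑ b ∈ box (3 + 1) n,
        (if blk n (((n : ℤ) • (X + unitVec m) + toSite b) + unitVec α) = blk n ((n : ℤ) • (X + unitVec m) + toSite b) then Si else Sf)
          * |Dsh (d := 3) n ((n : ℤ) • (X + unitVec m) + toSite b) ((n : ℤ) • X) (Sum.inl α) (Sum.inr m)|
      ≤ Si * ((n : ℝ) ^ (3 + 1) * (((3 : ℝ) + 1) * n)) + Sf * (((3 : ℝ) + 1) * ((((3 : ℕ) : ℝ) + 1) * (n : ℝ) ^ (3 + 1))) := by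
  classical
  have hn : 1 ≤ n := Nat.one_le_iff_ne_zero.2 (NeZero.ne n)
  have hpt : ∀ (α : Fin (3 + 1)) (b : Fin (3 + 1) → ℕ), b ∈ box (3 + 1) n →
      (if blk n (((n : ℤ) • (X + unitVec m) + toSite b) + unitVec α) = blk n ((n : ℤ) • (X + unitVec m) + toSite b) then Si else Sf)
          * |Dsh (d := 3) n ((n : ℤ) • (X + unitVec m) + toSite b) ((n : ℤ) • X) (Sum.inl α) (Sum.inr m)|
        ≤ Si * |Dsh (d := 3) n ((n : ℤ) • (X + unitVec m) + toSite b) ((n : ℤ) • X) (Sum.inl α) (Sum.inr m)|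
          + Sf * (if b α = n - 1 then |Dsh (d := 3) n ((n : ℤ) • (X + unitVec m) + toSite b) ((n : ℤ) • X) (Sum.inl α) (Sum.inr m)| else 0) := by
    intro α b hb
    have hD := abs_nonneg (Dsh (d := 3) n ((n : ℤ) • (X + unitVec m) + toSite b) ((n : ℤ) • X) (Sum.inl α) (Sum.inr m))
    split_ifs with h1 h2 h2
    · nlinarith
    · nlinarith
    · nlinarith
    · exact absurd (apply_eq_of_blk_ne hb h1) h2
  have e3 : (((3 : ℕ) : ℝ) + 1) = (3 : ℝ) + 1 := by norm_num
  have htot := sum_abs_Dsh_block_succ_le (d := 3) hn X m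
  rw [e3] at htot
  have hface : ∑ α : Fin (3 + 1), ∑ b ∈ box (3 + 1) n,
      (if b α = n - 1 then |Dsh (d := 3) n ((n : ℤ) • (X + unitVec m) + toSite b) ((n : ℤ) • X) (Sum.inl α) (Sum.inr m)| else 0)
        ≤ (((3 : ℝ) + 1) * ((((3 : ℕ) : ℝ) + 1) * (n : ℝ) ^ (3 + 1))) := by
    rcases Nat.lt_or_ge n 2 with h1 | h2
    · have hn1 : n = 1 := by omega
      calc ∑ α : Fin (3 + 1), ∑ b ∈ box (3 + 1) n,
            (if b α = n - 1 then |Dsh (d := 3) n ((n : ℤ) • (X + unitVec m) + toSite b) ((n : ℤ) • X) (Sum.inl α) (Sum.inr m)| else 0)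
          ≤ ∑ α : Fin (3 + 1), ∑ b ∈ box (3 + 1) n, |Dsh (d := 3) n ((n : ℤ) • (X + unitVec m) + toSite b) ((n : ℤ) • X) (Sum.inl α) (Sum.inr m)| :=
            Finset.sum_le_sum fun α _ => Finset.sum_le_sum fun b _ => by split_ifs <;> simp [abs_nonneg]
        _ ≤ ((n : ℝ) ^ (3 + 1) * (((3 : ℝ) + 1) * n)) := htot
        _ ≤ _ := by subst hn1; norm_num
    · have hv : n - 1 ≠ (n - 1) / 2 := by omega
      calc ∑ α : Fin (3 + 1), ∑ b ∈ box (3 + 1) n,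
            (if b α = n - 1 then |Dsh (d := 3) n ((n : ℤ) • (X + unitVec m) + toSite b) ((n : ℤ) • X) (Sum.inl α) (Sum.inr m)| else 0)
          = ∑ α : Fin (3 + 1), ∑ b ∈ (box (3 + 1) n).filter (fun b => b α = n - 1),
              |Dsh (d := 3) n ((n : ℤ) • (X + unitVec m) + toSite b) ((n : ℤ) • X) (Sum.inl α) (Sum.inr m)| :=
            Finset.sum_congr rfl fun α _ => by rw [Finset.sum_filter]
        _ ≤ ∑ α : Fin (3 + 1), ∑ α' : Fin (3 + 1), ∑ b ∈ (box (3 + 1) n).filter (fun b => b α = n - 1),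
              |Dsh (d := 3) n ((n : ℤ) • (X + unitVec m) + toSite b) ((n : ℤ) • X) (Sum.inl α') (Sum.inr m)| :=
            Finset.sum_le_sum fun α _ => Finset.single_le_sum
              (f := fun α' => ∑ b ∈ (box (3 + 1) n).filter (fun b => b α = n - 1),
                |Dsh (d := 3) n ((n : ℤ) • (X + unitVec m) + toSite b) ((n : ℤ) • X) (Sum.inl α') (Sum.inr m)|)
              (fun α' _ => Finset.sum_nonneg fun b _ => abs_nonneg _) (Finset.mem_univ α)
        _ ≤ ∑ _α : Fin (3 + 1), ((((3 : ℕ) : ℝ) + 1) * (n : ℝ) ^ (3 + 1)) :=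
            Finset.sum_le_sum fun α _ => sum_hyperplane_abs_Dsh_succ_le (d := 3) hn X m α hv
        _ = _ := by rw [Finset.sum_const, Finset.card_univ, Fintype.card_fin, nsmul_eq_mul]; push_cast; ring
  calc ∑ α : Fin (3 + 1), ∑ b ∈ box (3 + 1) n,
        (if blk n (((n : ℤ) • (X + unitVec m) + toSite b) + unitVec α) = blk n ((n : ℤ) • (X + unitVec m) + toSite b) then Si else Sf)
          * |Dsh (d := 3) n ((n : ℤ) • (X + unitVec m) + toSite b) ((n : ℤ) • X) (Sum.inl α) (Sum.inr m)|
      ≤ ∑ α : Fin (3 + 1), ∑ b ∈ box (3 + 1) n,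
          (Si * |Dsh (d := 3) n ((n : ℤ) • (X + unitVec m) + toSite b) ((n : ℤ) • X) (Sum.inl α) (Sum.inr m)|
            + Sf * (if b α = n - 1 then |Dsh (d := 3) n ((n : ℤ) • (X + unitVec m) + toSite b) ((n : ℤ) • X) (Sum.inl α) (Sum.inr m)| else 0)) :=
        Finset.sum_le_sum fun α _ => Finset.sum_le_sum fun b hb => hpt α b hb
    _ = Si * ∑ α : Fin (3 + 1), ∑ b ∈ box (3 + 1) n, |Dsh (d := 3) n ((n : ℤ) • (X + unitVec m) + toSite b) ((n : ℤ) • X) (Sum.inl α) (Sum.inr m)|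
        + Sf * ∑ α : Fin (3 + 1), ∑ b ∈ box (3 + 1) n,
          (if b α = n - 1 then |Dsh (d := 3) n ((n : ℤ) • (X + unitVec m) + toSite b) ((n : ℤ) • X) (Sum.inl α) (Sum.inr m)| else 0) := by
        simp only [Finset.sum_add_distrib, Finset.mul_sum]
    _ ≤ _ := add_le_add (mul_le_mul_of_nonneg_left htot hSi) (mul_le_mul_of_nonneg_left hface hSf)

/-- [folklore] **THE WEIGHTED COLUMN MASS OF `Dsh`'s FIELD–MULTIPLIER BLOCK** (interior bonds `Si`, face-crossing bonds `Sf`; `0 ≤ Si, Sf`):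
`Σ'_y Σ_α w(α,y)·|Dsh n y (n•X) (inl α) (inr m)| ≤ 2·(Si·(n^{3+1}·((3+1)·n)) + Sf·((3+1)·((3+1)·n^{3+1})))` — the two blocks `B(X)`, `B(X + e_m)`, every other block `0`. -/
theorem tsum_weight_abs_Dsh_col_le {Si Sf : ℝ} (hSi : 0 ≤ Si) (hSf : 0 ≤ Sf) (X : Site (3 + 1)) (m : Fin (3 + 1)) :
    (Summable fun y : Site (3 + 1) => ∑ α : Fin (3 + 1), (if blk n (y + unitVec α) = blk n y then Si else Sf) * |Dsh (d := 3) n y ((n : ℤ) • X) (Sum.inl α) (Sum.inr m)|) ∧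
      ∑' y : Site (3 + 1), ∑ α : Fin (3 + 1), (if blk n (y + unitVec α) = blk n y then Si else Sf) * |Dsh (d := 3) n y ((n : ℤ) • X) (Sum.inl α) (Sum.inr m)|
        ≤ 2 * (Si * ((n : ℝ) ^ (3 + 1) * (((3 : ℝ) + 1) * n)) + Sf * (((3 : ℝ) + 1) * ((((3 : ℕ) : ℝ) + 1) * (n : ℝ) ^ (3 + 1)))) := by
  have hn : 1 ≤ n := Nat.one_le_iff_ne_zero.2 (NeZero.ne n)
  have hw : ∀ (y : Site (3 + 1)) (α : Fin (3 + 1)), 0 ≤ (if blk n (y + unitVec α) = blk n y then Si else Sf) ∧ (if blk n (y + unitVec α) = blk n y then Si else Sf) ≤ Si + Sf := fun y α => by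
    split_ifs
    · exact ⟨hSi, by linarith⟩
    · exact ⟨hSf, by linarith⟩
  have hnn : ∀ y : Site (3 + 1), 0 ≤ ∑ α : Fin (3 + 1), (if blk n (y + unitVec α) = blk n y then Si else Sf) * |Dsh (d := 3) n y ((n : ℤ) • X) (Sum.inl α) (Sum.inr m)| :=
    fun y => Finset.sum_nonneg fun α _ => mul_nonneg (hw y α).1 (abs_nonneg _)
  have hdom : ∀ y : Site (3 + 1), ∑ α : Fin (3 + 1), (if blk n (y + unitVec α) = blk n y then Si else Sf) * |Dsh (d := 3) n y ((n : ℤ) • X) (Sum.inl α) (Sum.inr m)|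
      ≤ (Si + Sf) * ∑ α : Fin (3 + 1), |Dsh (d := 3) n y ((n : ℤ) • X) (Sum.inl α) (Sum.inr m)| := fun y => by
    rw [Finset.mul_sum]
    exact Finset.sum_le_sum fun α _ => mul_le_mul_of_nonneg_right (hw y α).2 (abs_nonneg _)
  have hs : Summable fun y : Site (3 + 1) => ∑ α : Fin (3 + 1), (if blk n (y + unitVec α) = blk n y then Si else Sf) * |Dsh (d := 3) n y ((n : ℤ) • X) (Sum.inl α) (Sum.inr m)| :=
    Summable.of_nonneg_of_le hnn hdom ((summable_abs_Dsh_col (n := n) X m).mul_left _)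
  refine ⟨hs, ?_⟩
  rw [tsum_blocks (N := n) hs]
  have hne : X ≠ X + unitVec m := by
    intro h; have := congrFun h m; simp [unitVec_apply] at this
  have hzero : ∀ Y ∉ ({X, X + unitVec m} : Finset (Site (3 + 1))),
      ∑ b ∈ box (3 + 1) n, ∑ α : Fin (3 + 1), (if blk n (((n : ℤ) • Y + toSite b) + unitVec α) = blk n ((n : ℤ) • Y + toSite b) then Si else Sf)
          * |Dsh (d := 3) n ((n : ℤ) • Y + toSite b) ((n : ℤ) • X) (Sum.inl α) (Sum.inr m)| = 0 := by
    intro Y hY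
    rw [Finset.mem_insert, Finset.mem_singleton, not_or] at hY
    refine Finset.sum_eq_zero fun b hb => Finset.sum_eq_zero fun α _ => ?_
    rw [Dsh_inl_inr_eq_zero_of_blk_ne hn (by rw [blk_block Y hb]; exact hY.1) (by rw [blk_block Y hb]; exact hY.2) α, abs_zero, mul_zero]
  rw [tsum_eq_sum hzero, Finset.sum_pair hne]
  have h1 := sum_weight_abs_Dsh_block_le (n := n) hSi hSf X m
  have h2 := sum_weight_abs_Dsh_block_succ_le (n := n) hSi hSf X m
  rw [Finset.sum_comm] at h1 h2
  linarith

variable (g h : Site (3 + 1) → Fib 3 → ℝ) {Cg Ch δ : ℝ} {yb yz : Site (3 + 1)}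

/-- [folklore] **THE WORD's WEIGHTED FIELD–MULTIPLIER COLUMN AT A COARSE POINT** (interior `Si`, face `Sf`): summable, and
`Σ'_y Σ_α Σ_m w(α,y)·|W y (n•X) (inl α) (inr m)| ≤ K(X)·(4·(2·(Si·T₀ + Sf·F₀)))`, `K(X)` the product of the two transported envelopes at `n•X`. -/
theorem word_col_wmass_le (hCg : 0 ≤ Cg) (hCh : 0 ≤ Ch) (hδ : 0 ≤ δ) {Si Sf : ℝ} (hSi : 0 ≤ Si) (hSf : 0 ≤ Sf)
    (hg : ∀ x a, |g x a| ≤ Cg * Real.exp (-δ * l1 (x - (n : ℤ) • yb))) (hh : ∀ x a, |h x a| ≤ Ch * Real.exp (-δ * l1 (x - (n : ℤ) • yz)))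
    (X : Site (3 + 1)) :
    (Summable fun y : Site (3 + 1) => ∑ α : Fin (3 + 1), ∑ m : Fin (3 + 1),
        (if blk n (y + unitVec α) = blk n y then Si else Sf) * |(comp (diagK h) (comp (diagK g) (Dsh (d := 3) n) - comp (Dsh (d := 3) n) (diagK g))
            - comp (comp (diagK g) (Dsh (d := 3) n) - comp (Dsh (d := 3) n) (diagK g)) (diagK h)) y ((n : ℤ) • X) (Sum.inl α) (Sum.inr m)|) ∧
      ∑' y : Site (3 + 1), ∑ α : Fin (3 + 1), ∑ m : Fin (3 + 1),
          (if blk n (y + unitVec α) = blk n y then Si else Sf) * |(comp (diagK h) (comp (diagK g) (Dsh (d := 3) n) - comp (Dsh (d := 3) n) (diagK g))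
            - comp (comp (diagK g) (Dsh (d := 3) n) - comp (Dsh (d := 3) n) (diagK g)) (diagK h)) y ((n : ℤ) • X) (Sum.inl α) (Sum.inr m)|
        ≤ (Ch * (Real.exp (δ * (((3 : ℝ) + 1) * (2 * n))) + 1) * Real.exp (-δ * l1 ((n : ℤ) • X - (n : ℤ) • yz)))
          * (Cg * (Real.exp (δ * (((3 : ℝ) + 1) * (2 * n))) + 1) * Real.exp (-δ * l1 ((n : ℤ) • X - (n : ℤ) • yb)))
          * (4 * (2 * (Si * ((n : ℝ) ^ (3 + 1) * (((3 : ℝ) + 1) * n)) + Sf * (((3 : ℝ) + 1) * ((((3 : ℕ) : ℝ) + 1) * (n : ℝ) ^ (3 + 1)))))) := by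
  set K : ℝ := (Ch * (Real.exp (δ * (((3 : ℝ) + 1) * (2 * n))) + 1) * Real.exp (-δ * l1 ((n : ℤ) • X - (n : ℤ) • yz)))
          * (Cg * (Real.exp (δ * (((3 : ℝ) + 1) * (2 * n))) + 1) * Real.exp (-δ * l1 ((n : ℤ) • X - (n : ℤ) • yb))) with hK
  have hK0 : 0 ≤ K := by positivity
  have hw0 : ∀ (y : Site (3 + 1)) (α : Fin (3 + 1)), 0 ≤ (if blk n (y + unitVec α) = blk n y then Si else Sf) := fun y α => by split_ifs <;> assumption
  have hpt : ∀ y, ∑ α : Fin (3 + 1), ∑ m : Fin (3 + 1), (if blk n (y + unitVec α) = blk n y then Si else Sf) * |(comp (diagK h) (comp (diagK g) (Dsh (d := 3) n) - comp (Dsh (d := 3) n) (diagK g))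
            - comp (comp (diagK g) (Dsh (d := 3) n) - comp (Dsh (d := 3) n) (diagK g)) (diagK h)) y ((n : ℤ) • X) (Sum.inl α) (Sum.inr m)|
      ≤ K * ∑ m : Fin (3 + 1), ∑ α : Fin (3 + 1), (if blk n (y + unitVec α) = blk n y then Si else Sf) * |Dsh (d := 3) n y ((n : ℤ) • X) (Sum.inl α) (Sum.inr m)| := by
    intro y
    rw [Finset.sum_comm, Finset.mul_sum]
    refine Finset.sum_le_sum fun m _ => ?_
    rw [Finset.mul_sum]
    refine Finset.sum_le_sum fun α _ => ?_
    have h1 := abs_word_le (n := n) g h hCg hCh hδ hg hh y ((n : ℤ) • X) (Sum.inl α) (Sum.inr m)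
    calc (if blk n (y + unitVec α) = blk n y then Si else Sf) * |(comp (diagK h) (comp (diagK g) (Dsh (d := 3) n) - comp (Dsh (d := 3) n) (diagK g))
            - comp (comp (diagK g) (Dsh (d := 3) n) - comp (Dsh (d := 3) n) (diagK g)) (diagK h)) y ((n : ℤ) • X) (Sum.inl α) (Sum.inr m)|
        ≤ (if blk n (y + unitVec α) = blk n y then Si else Sf) * (K * |Dsh (d := 3) n y ((n : ℤ) • X) (Sum.inl α) (Sum.inr m)|) := mul_le_mul_of_nonneg_left h1 (hw0 y α)
      _ = _ := by ring
  have hnn : ∀ y, 0 ≤ ∑ α : Fin (3 + 1), ∑ m : Fin (3 + 1), (if blk n (y + unitVec α) = blk n y then Si else Sf) * |(comp (diagK h) (comp (diagK g) (Dsh (d := 3) n) - comp (Dsh (d := 3) n) (diagK g))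
            - comp (comp (diagK g) (Dsh (d := 3) n) - comp (Dsh (d := 3) n) (diagK g)) (diagK h)) y ((n : ℤ) • X) (Sum.inl α) (Sum.inr m)| :=
    fun y => Finset.sum_nonneg fun α _ => Finset.sum_nonneg fun m _ => mul_nonneg (hw0 y α) (abs_nonneg _)
  have hsm : Summable fun y : Site (3 + 1) => K * ∑ m : Fin (3 + 1), ∑ α : Fin (3 + 1),
      (if blk n (y + unitVec α) = blk n y then Si else Sf) * |Dsh (d := 3) n y ((n : ℤ) • X) (Sum.inl α) (Sum.inr m)| :=
    (summable_sum fun m _ => (tsum_weight_abs_Dsh_col_le (n := n) hSi hSf X m).1).mul_left K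
  have hs := Summable.of_nonneg_of_le hnn hpt hsm
  refine ⟨hs, (Summable.tsum_le_tsum hpt hs hsm).trans ?_⟩
  rw [tsum_mul_left, Summable.tsum_finsetSum (fun m _ => (tsum_weight_abs_Dsh_col_le (n := n) hSi hSf X m).1)]
  refine mul_le_mul_of_nonneg_left ?_ hK0
  calc ∑ m : Fin (3 + 1), ∑' y : Site (3 + 1), ∑ α : Fin (3 + 1), (if blk n (y + unitVec α) = blk n y then Si else Sf) * |Dsh (d := 3) n y ((n : ℤ) • X) (Sum.inl α) (Sum.inr m)|
      ≤ ∑ _m : Fin (3 + 1), 2 * (Si * ((n : ℝ) ^ (3 + 1) * (((3 : ℝ) + 1) * n)) + Sf * (((3 : ℝ) + 1) * ((((3 : ℕ) : ℝ) + 1) * (n : ℝ) ^ (3 + 1)))) := Finset.sum_le_sum fun m _ => (tsum_weight_abs_Dsh_col_le (n := n) hSi hSf X m).2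
    _ = 4 * (2 * (Si * ((n : ℝ) ^ (3 + 1) * (((3 : ℝ) + 1) * n)) + Sf * (((3 : ℝ) + 1) * ((((3 : ℕ) : ℝ) + 1) * (n : ℝ) ^ (3 + 1))))) := by
        rw [Finset.sum_const, Finset.card_univ, Fintype.card_fin, nsmul_eq_mul]; push_cast; ring

/-- [folklore] **THE WORD's WEIGHTED FIELD–MULTIPLIER MASS, SUMMED OVER ALL COLUMNS**: `≤ (Ch·Cg·(E+1)²·(4·(2·(Si·T₀ + Sf·F₀)))·Zl 4 (δ∕2·n))·e^{−(δ∕2·n)|yz − yb|₁}`. -/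
theorem word_inl_inr_wmass_le (hCg : 0 ≤ Cg) (hCh : 0 ≤ Ch) (hδ : 0 < δ) {Si Sf : ℝ} (hSi : 0 ≤ Si) (hSf : 0 ≤ Sf)
    (hg : ∀ x a, |g x a| ≤ Cg * Real.exp (-δ * l1 (x - (n : ℤ) • yb))) (hh : ∀ x a, |h x a| ≤ Ch * Real.exp (-δ * l1 (x - (n : ℤ) • yz))) :
    (Summable fun x : Site (3 + 1) => ∑' y : Site (3 + 1), ∑ α : Fin (3 + 1), ∑ m : Fin (3 + 1),
        (if blk n (y + unitVec α) = blk n y then Si else Sf) * |(comp (diagK h) (comp (diagK g) (Dsh (d := 3) n) - comp (Dsh (d := 3) n) (diagK g))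
            - comp (comp (diagK g) (Dsh (d := 3) n) - comp (Dsh (d := 3) n) (diagK g)) (diagK h)) y x (Sum.inl α) (Sum.inr m)|) ∧
      ∑' x : Site (3 + 1), ∑' y : Site (3 + 1), ∑ α : Fin (3 + 1), ∑ m : Fin (3 + 1),
          (if blk n (y + unitVec α) = blk n y then Si else Sf) * |(comp (diagK h) (comp (diagK g) (Dsh (d := 3) n) - comp (Dsh (d := 3) n) (diagK g))
            - comp (comp (diagK g) (Dsh (d := 3) n) - comp (Dsh (d := 3) n) (diagK g)) (diagK h)) y x (Sum.inl α) (Sum.inr m)|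
        ≤ (Ch * Cg * (Real.exp (δ * (((3 : ℝ) + 1) * (2 * n))) + 1) ^ 2 * (4 * (2 * (Si * ((n : ℝ) ^ (3 + 1) * (((3 : ℝ) + 1) * n)) + Sf * (((3 : ℝ) + 1) * ((((3 : ℕ) : ℝ) + 1) * (n : ℝ) ^ (3 + 1))))))
            * Zl 4 (δ / 2 * n)) * Real.exp (-(δ / 2 * n) * l1 (yz - yb)) := by
  have hn0 : (n : ℤ) ≠ 0 := by exact_mod_cast NeZero.ne n
  have hnr : (0 : ℝ) < n := by exact_mod_cast Nat.pos_of_ne_zero (NeZero.ne n)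
  have hw0 : ∀ (y : Site (3 + 1)) (α : Fin (3 + 1)), 0 ≤ (if blk n (y + unitVec α) = blk n y then Si else Sf) := fun y α => by split_ifs <;> assumption
  set T : ℝ := 4 * (2 * (Si * ((n : ℝ) ^ (3 + 1) * (((3 : ℝ) + 1) * n)) + Sf * (((3 : ℝ) + 1) * ((((3 : ℕ) : ℝ) + 1) * (n : ℝ) ^ (3 + 1))))) with hT
  set E : ℝ := Real.exp (δ * (((3 : ℝ) + 1) * (2 * n))) + 1 with hE
  set Φ : Site (3 + 1) → ℝ := fun x => ∑' y : Site (3 + 1), ∑ α : Fin (3 + 1), ∑ m : Fin (3 + 1),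
        (if blk n (y + unitVec α) = blk n y then Si else Sf) * |(comp (diagK h) (comp (diagK g) (Dsh (d := 3) n) - comp (Dsh (d := 3) n) (diagK g))
            - comp (comp (diagK g) (Dsh (d := 3) n) - comp (Dsh (d := 3) n) (diagK g)) (diagK h)) y x (Sum.inl α) (Sum.inr m)| with hΦ
  have hinj : Function.Injective fun X : Site (3 + 1) => (n : ℤ) • X := smul_right_injective (Site (3 + 1)) hn0
  have hoff : ∀ x, x ∉ Set.range (fun X : Site (3 + 1) => (n : ℤ) • X) → Φ x = 0 := by
    intro x hx
    have hproj : Literature.Probability.LatticeModels.Torus.proj n x ≠ 0 := by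
      intro h0
      exact hx ⟨quo n x, (eq_zsmul_quo_of_proj (N := n) h0).symm⟩
    simp only [hΦ, word_inl_inr_eq_zero_of_proj_ne g h hproj, abs_zero, mul_zero, Finset.sum_const_zero, tsum_zero]
  have hcol : ∀ X : Site (3 + 1), Φ ((n : ℤ) • X) ≤ (Ch * Cg * E ^ 2 * T) * Real.exp (-(δ / 2 * n) * l1 (yz - yb))
      * Real.exp (-(δ / 2 * n) * l1 (X - yb)) := by
    intro X
    have h1 := (word_col_wmass_le g h hCg hCh hδ.le hSi hSf hg hh X).2
    have h2 := exp_two_centres hδ.le ((n : ℤ) • X) ((n : ℤ) • yb) ((n : ℤ) • yz)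
    have e1 : l1 ((n : ℤ) • yz - (n : ℤ) • yb) = (n : ℝ) * l1 (yz - yb) := by rw [← smul_sub, l1_natSmul]
    have e2 : l1 ((n : ℤ) • X - (n : ℤ) • yb) = (n : ℝ) * l1 (X - yb) := by rw [← smul_sub, l1_natSmul]
    rw [e1] at h2
    have ea : Real.exp (-(δ / 2) * ((n : ℝ) * l1 (yz - yb))) = Real.exp (-(δ / 2 * n) * l1 (yz - yb)) := by
      congr 1; ring
    have eb : Real.exp (-(δ / 2) * l1 ((n : ℤ) • X - (n : ℤ) • yb)) = Real.exp (-(δ / 2 * n) * l1 (X - yb)) := by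
      rw [e2]; congr 1; ring
    calc Φ ((n : ℤ) • X) ≤ (Ch * E * Real.exp (-δ * l1 ((n : ℤ) • X - (n : ℤ) • yz))) * (Cg * E * Real.exp (-δ * l1 ((n : ℤ) • X - (n : ℤ) • yb))) * T := h1
      _ = (Ch * Cg * E ^ 2 * T) * (Real.exp (-δ * l1 ((n : ℤ) • X - (n : ℤ) • yz)) * Real.exp (-δ * l1 ((n : ℤ) • X - (n : ℤ) • yb))) := by ring
      _ ≤ (Ch * Cg * E ^ 2 * T) * (Real.exp (-(δ / 2) * ((n : ℝ) * l1 (yz - yb))) * Real.exp (-(δ / 2) * l1 ((n : ℤ) • X - (n : ℤ) • yb))) :=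
          mul_le_mul_of_nonneg_left h2 (by positivity)
      _ = _ := by rw [ea, eb]; ring
  have hΦ0 : ∀ x, 0 ≤ Φ x := fun x => tsum_nonneg fun y => Finset.sum_nonneg fun α _ => Finset.sum_nonneg fun m _ => mul_nonneg (hw0 y α) (abs_nonneg _)
  have hδn : 0 < δ / 2 * n := by positivity
  have hmaj := (summable_exp_shift' (D := 3 + 1) hδn yb).mul_left ((Ch * Cg * E ^ 2 * T) * Real.exp (-(δ / 2 * n) * l1 (yz - yb)))
  have hsub : Summable fun X : Site (3 + 1) => Φ ((n : ℤ) • X) := Summable.of_nonneg_of_le (fun X => hΦ0 _) hcol hmaj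
  have hsum : Summable Φ := (hinj.summable_iff hoff).1 hsub
  refine ⟨hsum, ?_⟩
  rw [← hinj.tsum_eq (f := Φ) (fun x hx => by by_contra h'; exact hx (hoff x h'))]
  calc ∑' X : Site (3 + 1), Φ ((n : ℤ) • X)
      ≤ ∑' X : Site (3 + 1), (Ch * Cg * E ^ 2 * T) * Real.exp (-(δ / 2 * n) * l1 (yz - yb)) * Real.exp (-(δ / 2 * n) * l1 (X - yb)) :=
        Summable.tsum_le_tsum hcol hsub hmaj
    _ = (Ch * Cg * E ^ 2 * T) * Real.exp (-(δ / 2 * n) * l1 (yz - yb)) * Zl 4 (δ / 2 * n) := by rw [tsum_mul_left, tsum_exp_shift']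
    _ = _ := by ring

end Face

end Summit.QuantumFields.BalabanUV.Beta.D1BFx.DshWordFaceMass

end
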